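import Literature.AlgebraicGeometry.Resolution.CompletedPullbackRegular
import Literature.AlgebraicGeometry.Resolution.BlowupsFlatBaseChange
import HarnessLib

/-!
# Stalks of `Y ×_{Spec D} Spec E` at the points over `y₀`: the chart `Spec (𝒪_{Y,y₀} ⊗_D E)`

Topic: `Literature/AlgebraicGeometry/Resolution`. Infrastructure for clause (b) of the named fact
`DeJong1996SemiStableCodimTwoBlowupFlatNodal` (`AlterationsSemiStableCodimTwoBlowupFibres.lean`;
de Jong 1996, 3.4 Claim (ii): "completion and blowing up commute in a suitable manner"), where
the completed local rings of a blow-up `X' → X` at the points over a closed point `x₁` are compared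
with those of its base change `X' ×_X Spec 𝒪̂_{X,x₁}`, and the latter with those of the blow-up of
the algebraic model. Both comparisons rest on the description of the local rings of a base change
`Y ×_{Spec D} Spec E` at the points lying over a given point `y₀ ∈ Y`, PROVED here in the form of
a chart:

* `StalkOver q y₀` — the stalk `𝒪_{Y,y₀}` of a `D`-scheme `q : Y → Spec D` as a type with its
  `D`-algebra structure (the ring map whose `Spec` is `Spec 𝒪_{Y,y₀} → Y → Spec D`, `Spec` being
  fully faithful), `StalkOver.fromSpec : Spec 𝒪_{Y,y₀} → Y` (flat: `flat_fromSpecStalk`; a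
  preimmersion: Mathlib), with image the generizations of `y₀` (`range_stalkOver_fromSpec`);
* `stalkTensorChart E q y₀ : Spec (𝒪_{Y,y₀} ⊗_D E) → Y ×_{Spec D} Spec E` — the `specTensorChart`
  of `CompletedPullbackRegular.lean` through the local scheme at `y₀`: a FLAT PREIMMERSION (base
  change of `Spec 𝒪_{Y,y₀} → Y`), hence **inducing isomorphisms on all local rings**
  (`isIso_stalkMap_stalkTensorChart`, by `isIso_stalkMap_of_flat_of_isPreimmersion` of
  `BlowupsFlatBaseChange.lean`, Temkin 2008 §2.1), and hitting every point whose image in `Y` is a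
  generization of `y₀` (`exists_stalkTensorChart_eq`);
* `map_maximalIdeal_le_asIdeal` — a point of the chart over a point of `Y ×_{Spec D} Spec E` lying
  over `y₀` itself corresponds to a prime of `𝒪_{Y,y₀} ⊗_D E` containing `𝔪_{y₀} (𝒪_{Y,y₀} ⊗_D E)`
  (`Spec 𝒪_{Y,y₀} → Y` is injective with closed point `y₀`).

So the local ring of `Y ×_{Spec D} Spec E` at such a point is a localization of `𝒪_{Y,y₀} ⊗_D E` at a
prime over `𝔪_{y₀}` (the stalks of the affine chart being localizations, Mathlib).

## Sources

* M. Temkin, *Desingularization of quasi-excellent schemes in characteristic zero*, Adv. Math. 219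
  (2008), §2.1 (pro-open pro-subschemes), via `BlowupsFlatBaseChange.lean`. [Temkin2008]
* The Stacks Project, Tag 01J7 (points of `Spec 𝒪_{X,x}`). [StacksProject]
-/

noncomputable section

open CategoryTheory CategoryTheory.Limits AlgebraicGeometry TensorProduct

namespace Literature.AlgebraicGeometry.Resolution

universe u

section StalkBaseChange

variable {D : Type u} [CommRing D] (E : Type u) [CommRing E] [Algebra D E] {Y : Scheme.{u}}
  (q : Y ⟶ Spec (.of D)) (y₀ : Y)

/-- The stalk `𝒪_{Y,y₀}` of a `D`-scheme `q : Y → Spec D`, as a type carrying a `D`-algebra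
structure (a synonym, so that the structure is found by instance search). [folklore] -/
def StalkOver (_q : Y ⟶ Spec (.of D)) (y₀ : Y) : Type u := Y.presheaf.stalk y₀

/-- The ring structure of the stalk. [folklore] -/
instance : CommRing (StalkOver q y₀) := inferInstanceAs (CommRing (Y.presheaf.stalk y₀))
/-- The stalk is local. [folklore] -/
instance : IsLocalRing (StalkOver q y₀) := inferInstanceAs (IsLocalRing (Y.presheaf.stalk y₀))

/-- The identification `𝒪_{Y,y₀} ≅ StalkOver q y₀` in `CommRingCat`. [folklore] -/
def StalkOver.iso : Y.presheaf.stalk y₀ ≅ CommRingCat.of (StalkOver q y₀) := Iso.refl _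

/-- `Spec (StalkOver q y₀) → Y`, i.e. `Spec 𝒪_{Y,y₀} → Y` with its source written as the spectrum of
the synonym. [folklore] -/
def StalkOver.fromSpec : Spec (.of (StalkOver q y₀)) ⟶ Y :=
  Spec.map (StalkOver.iso q y₀).hom ≫ Y.fromSpecStalk y₀

/-- `Spec 𝒪_{Y,y₀} → Y` is flat (Stacks 01J7, `flat_fromSpecStalk`). [cite: StacksProject, Tag 01J7] -/
instance : Flat (StalkOver.fromSpec q y₀) := by
  haveI := flat_fromSpecStalk Y y₀
  unfold StalkOver.fromSpec
  infer_instance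

/-- `Spec 𝒪_{Y,y₀} → Y` is a preimmersion (Mathlib). [folklore] -/
instance : IsPreimmersion (StalkOver.fromSpec q y₀) := by
  unfold StalkOver.fromSpec
  infer_instance

/-- The image of `Spec 𝒪_{Y,y₀} → Y` is the set of generizations of `y₀`. [folklore] -/
theorem range_stalkOver_fromSpec : Set.range (StalkOver.fromSpec q y₀) = {y | y ⤳ y₀} := by
  unfold StalkOver.fromSpec
  rw [range_comp_of_surjective _ _ (Spec.map (StalkOver.iso q y₀).hom).surjective, Scheme.range_fromSpecStalk]

/-- The `D`-algebra structure of `StalkOver q y₀`: the ring map `D → 𝒪_{Y,y₀}` whose `Spec` is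
`Spec 𝒪_{Y,y₀} → Y → Spec D` (`Spec` is fully faithful). [folklore] -/
instance : Algebra D (StalkOver q y₀) :=
  (Spec.preimage (StalkOver.fromSpec q y₀ ≫ q)).hom.toAlgebra

/-- `Spec 𝒪_{Y,y₀} → Y → Spec D` is `Spec` of the algebra structure map. [folklore] -/
theorem fromSpecStalk_comp_eq :
    StalkOver.fromSpec q y₀ ≫ q =
      Spec.map (CommRingCat.ofHom (algebraMap D (StalkOver q y₀))) := by
  change _ = Spec.map (CommRingCat.ofHom (Spec.preimage (StalkOver.fromSpec q y₀ ≫ q)).hom)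
  rw [CommRingCat.ofHom_hom, Spec.map_preimage]

/-- **The chart `Spec (𝒪_{Y,y₀} ⊗_D E) → Y ×_{Spec D} Spec E`** through the local scheme at `y₀`
(`specTensorChart` with `i = Spec 𝒪_{Y,y₀} → Y`). [folklore] -/
def stalkTensorChart : Spec (.of (StalkOver q y₀ ⊗[D] E)) ⟶ pullback q (specOfAlgebra D E) :=
  specTensorChart E q (StalkOver.fromSpec q y₀) (fromSpecStalk_comp_eq q y₀)

/-- The chart is flat (a base change of the flat `Spec 𝒪_{Y,y₀} → Y`, up to isomorphisms). [folklore] -/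
instance stalkTensorChart_flat : Flat (stalkTensorChart E q y₀) := by
  unfold stalkTensorChart specTensorChart
  infer_instance

/-- The chart is a preimmersion (a base change of the preimmersion `Spec 𝒪_{Y,y₀} → Y`). [folklore] -/
instance stalkTensorChart_isPreimmersion : IsPreimmersion (stalkTensorChart E q y₀) := by
  unfold stalkTensorChart specTensorChart
  infer_instance

/-- The chart induces isomorphisms on all local rings. [folklore] -/
instance isIso_stalkMap_stalkTensorChart (t : Spec (.of (StalkOver q y₀ ⊗[D] E))) :
    IsIso ((stalkTensorChart E q y₀).stalkMap t) :=
  isIso_stalkMap_of_flat_of_isPreimmersion _ t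

/-- The chart hits every point of `Y ×_{Spec D} Spec E` whose image in `Y` is a generization of
`y₀`. [folklore] -/
theorem exists_stalkTensorChart_eq (y : ↑(pullback q (specOfAlgebra D E)))
    (hy : pullback.fst q (specOfAlgebra D E) y ⤳ y₀) :
    ∃ t, stalkTensorChart E q y₀ t = y := by
  have hrange : Set.range (stalkTensorChart E q y₀) =
      pullback.fst q (specOfAlgebra D E) ⁻¹' Set.range (StalkOver.fromSpec q y₀) := by
    unfold stalkTensorChart specTensorChart
    rw [range_comp_of_surjective _ _ (pullbackSpecIso D (StalkOver q y₀) E).inv.surjective,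
      range_comp_of_surjective _ _ (pullback.congrHom (fromSpecStalk_comp_eq q y₀) rfl).inv.surjective,
      range_comp_of_surjective _ _
        (pullbackRightPullbackFstIso q (specOfAlgebra D E) (StalkOver.fromSpec q y₀)).inv.surjective]
    exact Scheme.Pullback.range_snd _ _
  have : y ∈ Set.range (stalkTensorChart E q y₀) := by
    rw [hrange, Set.mem_preimage, range_stalkOver_fromSpec]
    exact hy
  exact this

/-- The closed point of `Spec (StalkOver q y₀)` maps to `y₀`. [folklore] -/
theorem stalkOver_fromSpec_closedPoint :
    StalkOver.fromSpec q y₀ (IsLocalRing.closedPoint (StalkOver q y₀)) = y₀ := by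
  unfold StalkOver.fromSpec
  rw [Scheme.Hom.comp_apply]
  haveI : IsLocalHom (StalkOver.iso q y₀).hom.hom := isLocalHom_of_isIso _
  rw [AlgebraicGeometry.Spec_closedPoint, Scheme.fromSpecStalk_closedPoint]

/-- A point of `Spec (StalkOver q y₀)` mapping to `y₀` is the closed point (`Spec 𝒪_{Y,y₀} → Y` is
injective). [folklore] -/
theorem eq_closedPoint_of_stalkOver_fromSpec_eq {s : Spec (.of (StalkOver q y₀))}
    (hs : StalkOver.fromSpec q y₀ s = y₀) : s = IsLocalRing.closedPoint (StalkOver q y₀) :=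
  (StalkOver.fromSpec q y₀).isEmbedding.injective (hs.trans (stalkOver_fromSpec_closedPoint q y₀).symm)

/-- **A point of the chart over a point of `Y ×_{Spec D} Spec E` lying over `y₀` itself has its prime
containing `𝔪_{y₀} (𝒪_{Y,y₀} ⊗_D E)`.** [folklore] -/
theorem map_maximalIdeal_le_asIdeal {t : Spec (.of (StalkOver q y₀ ⊗[D] E))}
    (ht : pullback.fst q (specOfAlgebra D E) (stalkTensorChart E q y₀ t) = y₀) :
    (IsLocalRing.maximalIdeal (StalkOver q y₀)).map
        (Algebra.TensorProduct.includeLeftRingHom (R := D) (A := StalkOver q y₀) (B := E)) ≤ t.asIdeal := by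
  set t' : Spec (.of (StalkOver q y₀)) :=
    Spec.map (CommRingCat.ofHom (Algebra.TensorProduct.includeLeftRingHom (R := D)
      (A := StalkOver q y₀) (B := E))) t with ht'
  have h1 : StalkOver.fromSpec q y₀ t' = y₀ := by
    rw [ht', ← Scheme.Hom.comp_apply, ← specTensorChart_fst E q (StalkOver.fromSpec q y₀)
      (fromSpecStalk_comp_eq q y₀)]
    exact ht
  have h2 := eq_closedPoint_of_stalkOver_fromSpec_eq q y₀ h1
  have h3 : t'.asIdeal = t.asIdeal.comap (Algebra.TensorProduct.includeLeftRingHom (R := D)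
      (A := StalkOver q y₀) (B := E)) := rfl
  rw [Ideal.map_le_iff_le_comap, ← h3, h2]
  exact le_rfl

end StalkBaseChange

end Literature.AlgebraicGeometry.Resolution
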